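import Summits.CriticalPhenomena.PercolationContinuityZ3.Theorems.PercNearOneGluingNoHeavyLowerTailCILPeeling
import Summits.CriticalPhenomena.PercolationContinuityZ3.Theorems.PercNearOneGluingNoHeavyLowerTailCILHyperedgeTools
import Summits.CriticalPhenomena.PercolationContinuityZ3.Theorems.PercNearOneGluingNoHeavyLowerTailCILOffObserverTransport
import HarnessLib

/-!
# `NoHeavyLowerTail` (stmt-CriticalPhenomena-4575) — star expansion of the SEPARATED margin of an observer set (identity form), and the
# double star expansion of the two-observer margin `F = CSdiff_w({s₁,s₂}, i)`

Support file (prover `prim-hp-3`, hull-port line; `--supports stmt-CriticalPhenomena-4575`).  No definitions, no named facts, no sorries.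
Step 1 of the assembly recipe for the overtaking bound (run/shared/lean/prim/prim-hp-3/PROOF-OVERTAKING-BOUND.md §6).

* `CutObserver.setCSdiff_star_expansion` — the IDENTITY behind `CutObserver.set_star_transfer` (…CILPeeling): for an observer set `S ∋ v`
  (`v ∉ A`), `c ∉ S`, and `v`'s positive pairs ending in `P ∌ v`:
  `μ(c ↮ S, |π(c)| ≤ j) − μ(c ↮ S, 1 ≤ |π(S)| ≤ j) = Σ_{B ⊆ P} μ(σ_B)·[μ(c ↮' S', |π'(c)| ≤ j) − μ(c ↮' S', 1 ≤ |π'(S')| ≤ j)]`,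
  `S' = (S ∖ v) ∪ B`, primes = read on `ω ∖ v`.
* `Hyperedge.pairCSdiff_double_star_expansion` — for two observers `s₁ ≠ s₂ ∉ A` with ports in `P₁`, `P₂` and a relay-side vertex `i ∉ {s₁,s₂} ∪ P₂`:
  `F = Σ_{S ⊆ P₂} μ_w(σ²_S) Σ_{T ⊆ P₁} μ_{w∖s₂}(σ¹_T) · f(T,S)` with the CELL
  `f(T,S) = μ_K(i ↮ S∪T, |π(i)| ≤ j) − μ_K(i ↮ S∪T, 1 ≤ |π(S∪T)| ≤ j)`, `K = (w∖s₂)∖s₁`, honest events of `ω` (no `ω ∖ o`):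
  `Hyperedge.setCS_pair_star_expansion` at `s₂`, `Hyperedge.real_reachFunctional_offObserver`, `setCSdiff_star_expansion` at `s₁`, transport again.
-/

noncomputable section

namespace Summit.CriticalPhenomena.PercolationContinuityZ3.Theorems

open MeasureTheory Set Literature.Probability.LatticeModels Literature.Probability.Percolation
open scoped Classical BigOperators

variable {n : ℕ}

namespace CutObserver

open KNPreFKG

/-- **Star expansion of a separated margin (identity).**  `S ∋ v` an observer set with `v ∉ A`, `c ∉ S`, positive pairs of `v` inside `P ∌ v`:
`μ(c ↮ S, |π(c)| ≤ j) − μ(c ↮ S, 1 ≤ |π(S)| ≤ j) = Σ_{B ⊆ P} μ(σ_B)·[μ(c ↮' S', |π'(c)| ≤ j) − μ(c ↮' S', 1 ≤ |π'(S')| ≤ j)]`,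
`S' = (S ∖ v) ∪ B`, events with a prime read on `ω ∩ {e | v ∉ e}`. [folklore] -/
theorem setCSdiff_star_expansion (w : Sym2 (Fin n) → unitInterval) (A S : Finset (Fin n)) (v c : Fin n) (P : Finset (Fin n))
    (j : ℕ) (hvS : v ∈ S) (hvA : v ∉ A) (hcS : c ∉ S) (hvP : v ∉ P) (hobs : ∀ u, u ≠ v → u ∉ P → w s(v, u) = 0) :
    (prodBernoulli w).real {ω : BondConfig (Fin n) | (∀ x ∈ S, ¬ (openGraph ω).Reachable c x) ∧
        (A.filter fun z => (openGraph ω).Reachable c z).card ≤ j} -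
      (prodBernoulli w).real {ω : BondConfig (Fin n) | (∀ x ∈ S, ¬ (openGraph ω).Reachable c x) ∧
        1 ≤ (A.filter fun z => ∃ x ∈ S, (openGraph ω).Reachable x z).card ∧
        (A.filter fun z => ∃ x ∈ S, (openGraph ω).Reachable x z).card ≤ j} =
    ∑ B ∈ P.powerset, (prodBernoulli w).real (starEvent v (↑B : Set (Fin n))) *
      ((prodBernoulli w).real {ω : BondConfig (Fin n) |
          (∀ y ∈ S.erase v ∪ B, ¬ (openGraph (ω ∩ {e | v ∉ e})).Reachable c y) ∧
            (A.filter fun z => (openGraph (ω ∩ {e | v ∉ e})).Reachable c z).card ≤ j} -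
        (prodBernoulli w).real {ω : BondConfig (Fin n) |
          (∀ y ∈ S.erase v ∪ B, ¬ (openGraph (ω ∩ {e | v ∉ e})).Reachable c y) ∧
            1 ≤ (A.filter fun z => ∃ y ∈ S.erase v ∪ B, (openGraph (ω ∩ {e | v ∉ e})).Reachable y z).card ∧
            (A.filter fun z => ∃ y ∈ S.erase v ∪ B, (openGraph (ω ∩ {e | v ∉ e})).Reachable y z).card ≤ j}) := by
  set μ := prodBernoulli w with hμ
  set RS := {ω : BondConfig (Fin n) | (∀ x ∈ S, ¬ (openGraph ω).Reachable c x) ∧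
    (A.filter fun z => (openGraph ω).Reachable c z).card ≤ j} with hRS
  set LS := {ω : BondConfig (Fin n) | (∀ x ∈ S, ¬ (openGraph ω).Reachable c x) ∧
    1 ≤ (A.filter fun z => ∃ x ∈ S, (openGraph ω).Reachable x z).card ∧
    (A.filter fun z => ∃ x ∈ S, (openGraph ω).Reachable x z).card ≤ j} with hLS
  rw [real_eq_sum_inter_starEvent w P v hvP hobs RS, real_eq_sum_inter_starEvent w P v hvP hobs LS, ← Finset.sum_sub_distrib]
  refine Finset.sum_congr rfl fun B hB => ?_
  have hBP : B ⊆ P := Finset.mem_powerset.1 hB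
  have hBv : ∀ y ∈ B, y ≠ v := fun y hy h => hvP (h ▸ hBP hy)
  set σ := starEvent v (↑B : Set (Fin n)) with hσdef
  set S' := S.erase v ∪ B with hS'
  set PL : BondConfig (Fin n) → Prop := fun ξ =>
    (∀ y ∈ S', ¬ (openGraph ξ).Reachable c y) ∧
      1 ≤ (A.filter fun z => ∃ y ∈ S', (openGraph ξ).Reachable y z).card ∧
      (A.filter fun z => ∃ y ∈ S', (openGraph ξ).Reachable y z).card ≤ j with hPL
  set PR : BondConfig (Fin n) → Prop := fun ξ =>
    (∀ y ∈ S', ¬ (openGraph ξ).Reachable c y) ∧ (A.filter fun z => (openGraph ξ).Reachable c z).card ≤ j with hPR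
  -- π(S) = π'(S') on σ (relays are ≠ v)
  have hfilt : ∀ ω ∈ σ, (A.filter fun z => ∃ x ∈ S, (openGraph ω).Reachable x z) =
      (A.filter fun z => ∃ y ∈ S', (openGraph (ω ∩ {e | v ∉ e})).Reachable y z) := by
    intro ω hω
    refine Finset.filter_congr fun z hz => ?_
    have hzv : z ≠ v := fun h => hvA (h ▸ hz)
    exact exists_reachable_set_iff_star hω hvS hBv hzv
  -- off S, π(c) = π'(c)
  have hfiltc : ∀ ω : BondConfig (Fin n), (∀ x ∈ S, ¬ (openGraph ω).Reachable c x) →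
      (A.filter fun z => (openGraph ω).Reachable c z) = (A.filter fun z => (openGraph (ω ∩ {e | v ∉ e})).Reachable c z) := by
    intro ω h
    have hcv : ¬ (openGraph ω).Reachable c v := h v hvS
    refine Finset.filter_congr fun z _ => ⟨fun hz => ?_, fun hz => reachable_mono inter_subset_left hz⟩
    exact reachable_avoiding_of_not_reachable hcv hz
  have hL : LS ∩ σ = σ ∩ {ω | PL (ω ∩ {e | v ∉ e})} := by
    ext ω
    simp only [hLS, mem_inter_iff, mem_setOf_eq]
    constructor
    · rintro ⟨⟨hsep, h1, h2⟩, hω⟩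
      refine ⟨hω, (forall_not_reachable_set_iff_star hω hvS hBv hcS).1 hsep, ?_, ?_⟩
      · rw [← hfilt ω hω]; exact h1
      · rw [← hfilt ω hω]; exact h2
    · rintro ⟨hω, hsep, h1, h2⟩
      refine ⟨⟨(forall_not_reachable_set_iff_star hω hvS hBv hcS).2 hsep, ?_, ?_⟩, hω⟩
      · rw [hfilt ω hω]; exact h1
      · rw [hfilt ω hω]; exact h2
  have hR : RS ∩ σ = σ ∩ {ω | PR (ω ∩ {e | v ∉ e})} := by
    ext ω
    simp only [hRS, mem_inter_iff, mem_setOf_eq]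
    constructor
    · rintro ⟨⟨hsep, h2⟩, hω⟩
      refine ⟨hω, (forall_not_reachable_set_iff_star hω hvS hBv hcS).1 hsep, ?_⟩
      rw [← hfiltc ω hsep]; exact h2
    · rintro ⟨hω, hsep, h2⟩
      have hsep' := (forall_not_reachable_set_iff_star hω hvS hBv hcS).2 hsep
      refine ⟨⟨hsep', ?_⟩, hω⟩
      rw [hfiltc ω hsep']; exact h2
  rw [hL, hR, measureReal_starEvent_inter_avoid w v ↑B PL, measureReal_starEvent_inter_avoid w v ↑B PR]
  ring

end CutObserver

namespace Hyperedge

open CutObserver KNPreFKG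

/-- **Double star expansion of the two-observer separated margin.**  See the file header: `F = Σ_S μ_w(σ²_S) Σ_T μ_{w∖s₂}(σ¹_T) f(T,S)` with honest
cells `f(T,S) = μ_K(i ↮ S∪T, |π(i)| ≤ j) − μ_K(i ↮ S∪T, 1 ≤ |π(S∪T)| ≤ j)`, `K = (w∖s₂)∖s₁`. [folklore] -/
theorem pairCSdiff_double_star_expansion (w : Sym2 (Fin n) → unitInterval) (A : Finset (Fin n)) (s₁ s₂ i : Fin n)
    (P₁ P₂ : Finset (Fin n)) (j : ℕ) (h1A : s₁ ∉ A) (h2A : s₂ ∉ A) (h12 : s₁ ≠ s₂) (hi1 : i ≠ s₁) (hi2 : i ≠ s₂)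
    (h1P1 : s₁ ∉ P₁) (h2P2 : s₂ ∉ P₂) (h1P2 : s₁ ∉ P₂) (hiP2 : i ∉ P₂)
    (hobs₁ : ∀ y, y ≠ s₁ → y ∉ P₁ → w s(s₁, y) = 0) (hobs₂ : ∀ y, y ≠ s₂ → y ∉ P₂ → w s(s₂, y) = 0) :
    (prodBernoulli w).real {ω : BondConfig (Fin n) | (∀ x ∈ ({s₁, s₂} : Finset (Fin n)), ω ∉ openConn i x) ∧
        (A.filter fun z => ω ∈ openConn i z).card ≤ j} -
      (prodBernoulli w).real {ω : BondConfig (Fin n) | (∀ x ∈ ({s₁, s₂} : Finset (Fin n)), ω ∉ openConn i x) ∧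
        1 ≤ (A.filter fun z => ∃ x ∈ ({s₁, s₂} : Finset (Fin n)), ω ∈ openConn x z).card ∧
        (A.filter fun z => ∃ x ∈ ({s₁, s₂} : Finset (Fin n)), ω ∈ openConn x z).card ≤ j} =
    ∑ S ∈ P₂.powerset, (prodBernoulli w).real (starEvent s₂ (↑S : Set (Fin n))) *
      ∑ T ∈ P₁.powerset,
        (prodBernoulli (fun e => if s₂ ∈ e then (0 : unitInterval) else w e)).real (starEvent s₁ (↑T : Set (Fin n))) *
        ((prodBernoulli (fun e => if s₁ ∈ e then (0 : unitInterval) else if s₂ ∈ e then (0 : unitInterval) else w e)).real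
            {ω : BondConfig (Fin n) | (∀ y ∈ S ∪ T, ¬ (openGraph ω).Reachable i y) ∧
              (A.filter fun z => (openGraph ω).Reachable i z).card ≤ j} -
          (prodBernoulli (fun e => if s₁ ∈ e then (0 : unitInterval) else if s₂ ∈ e then (0 : unitInterval) else w e)).real
            {ω : BondConfig (Fin n) | (∀ y ∈ S ∪ T, ¬ (openGraph ω).Reachable i y) ∧
              1 ≤ (A.filter fun z => ∃ y ∈ S ∪ T, (openGraph ω).Reachable y z).card ∧
              (A.filter fun z => ∃ y ∈ S ∪ T, (openGraph ω).Reachable y z).card ≤ j}) := by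
  set w₂ : Sym2 (Fin n) → unitInterval := fun e => if s₂ ∈ e then (0 : unitInterval) else w e with hw₂
  -- (1) expand at `s₂`
  rw [setCS_pair_star_expansion w A s₁ s₂ i P₂ j h2A h12 hi1 hi2 h2P2 hobs₂]
  refine Finset.sum_congr rfl fun S hS => ?_
  have hSP : S ⊆ P₂ := Finset.mem_powerset.1 hS
  have hiS : i ∉ S := fun h => hiP2 (hSP h)
  have h1S : s₁ ∉ S := fun h => h1P2 (hSP h)
  congr 1
  -- (2) transport both inner events off `s₂`
  have tR := real_reachFunctional_offObserver w s₂
    (fun R => (∀ y ∈ {s₁} ∪ S, ¬ R i y) ∧ (A.filter fun z => R i z).card ≤ j)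
  have tL := real_reachFunctional_offObserver w s₂
    (fun R => (∀ y ∈ {s₁} ∪ S, ¬ R i y) ∧ 1 ≤ (A.filter fun z => ∃ y ∈ {s₁} ∪ S, R y z).card ∧
      (A.filter fun z => ∃ y ∈ {s₁} ∪ S, R y z).card ≤ j)
  beta_reduce at tR tL
  -- (3) expand at `s₁` under `w ∖ s₂`, observer set `{s₁} ∪ S`
  have hobs₁' : ∀ y, y ≠ s₁ → y ∉ P₁ → w₂ s(s₁, y) = 0 := by
    intro y hy hyP
    simp only [hw₂]
    split_ifs with h
    · rfl
    · exact hobs₁ y hy hyP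
  have h1mem : s₁ ∈ ({s₁} ∪ S : Finset (Fin n)) := Finset.mem_union_left _ (Finset.mem_singleton_self _)
  have himem : i ∉ ({s₁} ∪ S : Finset (Fin n)) := by
    rw [Finset.mem_union, Finset.mem_singleton, not_or]; exact ⟨hi1, hiS⟩
  have g1 := setCSdiff_star_expansion w₂ A ({s₁} ∪ S) s₁ i P₁ j h1mem h1A himem h1P1 hobs₁'
  have hSe : ({s₁} ∪ S : Finset (Fin n)).erase s₁ = S := by
    ext x
    simp only [Finset.mem_erase, Finset.mem_union, Finset.mem_singleton]
    constructor
    · rintro ⟨hne, h | h⟩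
      · exact absurd h hne
      · exact h
    · intro h
      exact ⟨fun hx => h1S (hx ▸ h), Or.inr h⟩
  simp only [hSe] at g1
  -- chain: (2) then (3)
  refine Eq.trans ?_ (Eq.trans g1 ?_)
  · have h2 := congrArg₂ (fun a b : ℝ => a - b) tR tL
    beta_reduce at h2
    convert h2
  refine Finset.sum_congr rfl fun T _ => ?_
  congr 1
  -- (4) transport both cells off `s₁`
  have uR := real_reachFunctional_offObserver w₂ s₁
    (fun R => (∀ y ∈ S ∪ T, ¬ R i y) ∧ (A.filter fun z => R i z).card ≤ j)
  have uL := real_reachFunctional_offObserver w₂ s₁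
    (fun R => (∀ y ∈ S ∪ T, ¬ R i y) ∧ 1 ≤ (A.filter fun z => ∃ y ∈ S ∪ T, R y z).card ∧
      (A.filter fun z => ∃ y ∈ S ∪ T, R y z).card ≤ j)
  beta_reduce at uR uL
  have h4 := congrArg₂ (fun a b : ℝ => a - b) uR uL
  beta_reduce at h4
  convert h4

end Hyperedge

end Summit.CriticalPhenomena.PercolationContinuityZ3.Theorems
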